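import Summits.CriticalPhenomena.SAWScalingLimit.Theses.SAWRenewalTightness
import Summits.CriticalPhenomena.SAWScalingLimit.Theses.SAWRestrictionRigidity
import Summits.CriticalPhenomena.SAWScalingLimit.Theses.SAWWeldingIdentification
import Summits.CriticalPhenomena.SAWScalingLimit.Theorems.SAWRenewalTightnessTightOfShellCrossing
import Summits.CriticalPhenomena.SAWScalingLimit.Theorems.SAWRenewalTightnessShellCrossingBoundTravCount
import Summits.CriticalPhenomena.SAWScalingLimit.Theorems.SAWRenewalTightnessEventualTightOfBoundedVirginArc
import Summits.CriticalPhenomena.SAWScalingLimit.Theorems.SAWRenewalTightnessEventualTightSketchDefs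
import Summits.CriticalPhenomena.SAWScalingLimit.Theorems.SAWTotalPositivityTPToTraversalBoundBoundaryShellsAux
import Summits.CriticalPhenomena.SAWScalingLimit.Theorems.BulkShellTight.Negative.OfEventualTight
import Summits.CriticalPhenomena.SAWScalingLimit.Theorems.EventualTight.Negative.TightnessNecessary

/-!
# `EventualTight ↔ BulkShellTight ∧ BoundaryShellTight` — the E-free bulk/boundary decomposition of the crux

Strategist s4 on the crux `EventualTight` (stmt-CriticalPhenomena-1372; byte-identical copies in the route files
`SAWRenewalTightness`, `SAWRestrictionRigidity`, `SAWWeldingIdentification`).  Sorry-free glue supporting the line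
`Cruxes/EventualTight/Lines/boundary_bulk.lean`.

* `fatShellTight_of_bulkShellTight_of_boundaryShellTight` — per-shell count tightness at every FAT shell
  `D(x; ρ, R)`, `14ρ ≤ R ≤ 1`, from the bulk child `BulkShellTight` (stmt-17588: interior shells with the collar
  `closedBall y (2R) ⊆ Ω`) and the frontier-centred statement `TPToTraversalBound.Radial.BoundaryShellTight`
  (isolated on the route SAWTotalPositivity, crux stmt-10687, line `radial-portal-transfer` rev 4): if
  `closedBall x (2ρ) ⊆ Ω` THIN the shell to an interior one (compactness; the event only grows,
  `Curve.HasTraversals.mono'`); otherwise either the inner ball misses `Ω̄` (no traversal,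
  `Radial.not_hasTraversals_of_disjoint`) or some frontier point `y` has `dist x y ≤ 2ρ` and the traversals are
  traversals of the frontier-centred shell `D(y; 3ρ, R − 2ρ)` of aspect `≥ 4` (`Curve.HasTraversals.mono`).
* `shellCrossing_of_fatShellDecay` — fat per-shell count tightness for one `(D, a, b)` already gives that triple's
  `ShellCrossingBound` conclusion with `K = 14³`, `λ = 3`, `δ₀ = 1` (thin shells are free,
  `Radial.law_le_bound_of_le_mul`; coarse meshes by the landed count `stub_travCount`) — the fat-only variant of
  `shellCrossing_of_perShellDecay`.
* `eventualTight_of_bulkShellTight_of_boundaryShellTight : BulkShellTight → BoundaryShellTight → EventualTight`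
  (through the landed criterion `TightOfShellCrossing_proof`) — NO restriction positivity E
  (`ConfinementPositivity`, stmt-17587), no enlargement of the domain; with the landed necessities
  (`BulkShellTight.Negative.bulkShellTight_of_eventualTight`, and `boundaryShellTight_of_eventualTight` here) the
  decomposition is EXACT: `eventualTight_iff_bulkShellTight_and_boundaryShellTight`.
* `eventualTight_of_virginArcTraversalTightBounded_of_boundaryShellTight` — the line's composition: the bulk atom
  X2c₁ᵇ (stmt-18042) replaces `BulkShellTight` through `bulkShellTight_of_virginArcTraversalTightBounded` (p151500).
* Honesty of the boundary statement: `boundaryShellTight_of_eventualTight`, `not_eventualTight_of_not_boundaryShellTight`,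
  `boundaryShellTight_of_sawScalingLimit`, `not_sawScalingLimit_of_not_boundaryShellTight` (summit-safe; negatives-index
  forms), and `boundaryShellTight_of_virginArcTraversalTightBounded_of_confinementPositivity` (the split of record
  {X2c₁ᵇ, E} implies the new pair {X2c₁ᵇ, B}).
-/

noncomputable section

namespace Summit.CriticalPhenomena.SAWScalingLimit.Theorems

open MeasureTheory Set Metric
open scoped ENNReal
open Literature.Probability.RandomPlanarGeometry Literature.Probability.LatticeModels
open Summit.CriticalPhenomena.SAWScalingLimit.Theses.SAWRenewalTightness
open Summit.CriticalPhenomena.SAWScalingLimit.Theorems.TPToTraversalBound (Radial.BoundaryShellTight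
  Radial.not_hasTraversals_of_disjoint Radial.exists_mem_frontier_dist_le Radial.law_le_bound_of_le_mul)

/-- **Fat-shell count tightness from the bulk/boundary dichotomy.**  For a fat shell `D(x; ρ, R)`, `14ρ ≤ R ≤ 1`:
if `closedBall x (2ρ) ⊆ Ω`, thin it to an interior shell `D(x; ρ, R')` with `closedBall x (2R') ⊆ Ω` and use the bulk
statement; else, unless the inner ball misses `Ω̄` (empty event), re-centre at a frontier point within `2ρ` to the
frontier-centred shell `D(y; 3ρ, R − 2ρ)` of aspect `≥ 4` and use the boundary statement. [folklore glue] -/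
theorem fatShellTight_of_bulkShellTight_of_boundaryShellTight
    (hBulk : BulkShellTight)
    (hBdry : Radial.BoundaryShellTight)
    (D : DobrushinDomain) (a b : ℝ → Site 2) (hab : SAW.IsEndpointApprox D a b) :
    ∀ (x : ℂ) (ρ R : ℝ), 0 < ρ → 14 * ρ ≤ R → R ≤ 1 → ∀ ε : ℝ, 0 < ε → ∃ (k : ℕ) (δ₁ : ℝ), 0 < δ₁ ∧
      ∀ δ ∈ Set.Ioc (0 : ℝ) δ₁,
        SAW.law D.carrier δ (a δ) (b δ)
          {γ | (⟨γ.walk.toCurve (meshPoint δ)⟩ : Curve ℂ).HasTraversals k x ρ R} ≤ ENNReal.ofReal ε := by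
  intro x ρ R hρ h14 hR1 ε hε
  have hρR : ρ < R := by linarith
  by_cases hin : Metric.closedBall x (2 * ρ) ⊆ D.carrier
  · -- BULK: thin the shell inside the domain
    obtain ⟨ε', hε', hsub⟩ :=
      (isCompact_closedBall x (2 * ρ)).exists_cthickening_subset_open D.isOpen hin
    rw [cthickening_closedBall hε'.le (by positivity)] at hsub
    set R' : ℝ := min R (ρ + ε' / 2) with hR'def
    have hρR' : ρ < R' := lt_min hρR (by linarith)
    have hR'R : R' ≤ R := min_le_left _ _
    have h2R' : Metric.closedBall x (2 * R') ⊆ D.carrier := by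
      refine subset_trans (Metric.closedBall_subset_closedBall ?_) hsub
      have : R' ≤ ρ + ε' / 2 := min_le_right _ _
      linarith
    obtain ⟨j, δ₁, hδ₁, hj⟩ := hBulk D a b hab x ρ R' hρ hρR' h2R' ε hε
    refine ⟨j, δ₁, hδ₁, fun δ hδ => le_trans (measure_mono fun γ hγ => ?_) (hj δ hδ)⟩
    exact Curve.HasTraversals.mono' hγ le_rfl hR'R
  · -- BOUNDARY: a point of the complement within `2ρ` of the centre
    obtain ⟨z, hzx, hzD⟩ := Set.not_subset.1 hin
    rw [Metric.mem_closedBall] at hzx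
    by_cases hfar : Disjoint (Metric.closedBall x ρ) (closure D.carrier)
    · -- far shell: never traversed
      refine ⟨1, 1, one_pos, fun δ hδ => ?_⟩
      have h0 : SAW.law D.carrier δ (a δ) (b δ)
          {γ | (⟨γ.walk.toCurve (meshPoint δ)⟩ : Curve ℂ).HasTraversals 1 x ρ R} = 0 :=
        measure_mono_null (fun γ hγ => Radial.not_hasTraversals_of_disjoint γ hfar one_ne_zero hρR hγ)
          measure_empty
      rw [h0]
      exact bot_le
    · -- a frontier point within `2ρ`
      obtain ⟨y, hyf, hyd⟩ : ∃ y ∈ frontier D.carrier, dist x y ≤ 2 * ρ := by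
        by_cases hxD : x ∈ D.carrier
        · obtain ⟨y, hyf, hyd⟩ :=
            exists_mem_frontier_infDist_compl_eq_dist hxD D.toJordanDomain.carrier_ne_univ
          refine ⟨y, hyf, ?_⟩
          rw [← hyd]
          calc Metric.infDist x D.carrierᶜ ≤ dist x z := Metric.infDist_le_dist_of_mem hzD
            _ ≤ 2 * ρ := by rwa [dist_comm]
        · obtain ⟨y, hyf, hyd⟩ :=
            Radial.exists_mem_frontier_dist_le D.isOpen hxD (Set.not_disjoint_iff_nonempty_inter.1 hfar)
          exact ⟨y, hyf, hyd.trans (by linarith)⟩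
      -- re-centre: traversals of `D(x; ρ, R)` are traversals of `D(y; 3ρ, R - 2ρ)`, aspect `≥ 4`
      obtain ⟨k, δ₀, hδ₀, hk⟩ :=
        hBdry D a b hab y (3 * ρ) (R - 2 * ρ) hyf (by positivity) (by linarith) (by linarith) ε hε
      refine ⟨k, δ₀, hδ₀, fun δ hδ => le_trans (measure_mono fun γ hγ => ?_) (hk δ hδ)⟩
      exact Curve.HasTraversals.mono hγ (by linarith) (by linarith)

/-- **Fat per-shell count tightness ⟹ the crux's bound** for one `(D, a, b)`, with `K = 14³`, `λ = 3` and the GLOBAL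
mesh threshold `δ₀ = 1` (the fat-only variant of the landed `Theorems.shellCrossing_of_perShellDecay`): for a fat shell
`14ρ ≤ R ≤ 1` take `ε = (ρ/R)³`, the `k₁, δ₁` of per-shell tightness and the `N` of the landed coarse-mesh count
`Theorems.stub_travCount` at `(ρ, δ₁)`; the threshold `max k₁ N` works for `δ ≤ δ₁` by monotonicity in `k` and for
`δ > δ₁` because the event is empty; THIN shells `R < 14ρ` are free (`law_le_bound_of_le_mul`: `14³ (ρ/R)³ ≥ 1`).
[folklore glue] -/
theorem shellCrossing_of_fatShellDecay (D : DobrushinDomain) (a b : ℝ → Site 2)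
    (hP : ∀ (x : ℂ) (ρ R : ℝ), 0 < ρ → 14 * ρ ≤ R → R ≤ 1 → ∀ ε : ℝ, 0 < ε → ∃ (k : ℕ) (δ₁ : ℝ), 0 < δ₁ ∧
      ∀ δ ∈ Set.Ioc (0 : ℝ) δ₁,
        SAW.law D.carrier δ (a δ) (b δ)
          {γ | (⟨γ.walk.toCurve (meshPoint δ)⟩ : Curve ℂ).HasTraversals k x ρ R} ≤ ENNReal.ofReal ε) :
    ∃ (k : ℂ → ℝ → ℝ → ℕ) (K lam δ₀ : ℝ), 2 < lam ∧ 0 < δ₀ ∧ ∀ δ ∈ Set.Ioc (0 : ℝ) δ₀,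
      ∀ (x : ℂ) (ρ R : ℝ), δ ≤ ρ → ρ < R → R ≤ 1 →
        SAW.law D.carrier δ (a δ) (b δ)
            {γ | (⟨γ.walk.toCurve (meshPoint δ)⟩ : Curve ℂ).HasTraversals (k x ρ R) x ρ R} ≤
          ENNReal.ofReal (K * (ρ / R) ^ lam) := by
  classical
  have key : ∀ (x : ℂ) (ρ R : ℝ), ∃ k : ℕ, 0 < ρ → ρ < R → R ≤ 1 → ∀ δ ∈ Set.Ioc (0 : ℝ) 1,
      SAW.law D.carrier δ (a δ) (b δ)
          {γ | (⟨γ.walk.toCurve (meshPoint δ)⟩ : Curve ℂ).HasTraversals k x ρ R} ≤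
        ENNReal.ofReal ((14 : ℝ) ^ (3 : ℝ) * (ρ / R) ^ (3 : ℝ)) := by
    intro x ρ R
    by_cases h : 0 < ρ ∧ 14 * ρ ≤ R ∧ R ≤ 1
    · obtain ⟨hρ, h14, hR1⟩ := h
      have hρR : ρ < R := by linarith
      have hε : 0 < (ρ / R) ^ (3 : ℝ) := Real.rpow_pos_of_pos (div_pos hρ (hρ.trans hρR)) _
      have hKε : ENNReal.ofReal ((ρ / R) ^ (3 : ℝ)) ≤
          ENNReal.ofReal ((14 : ℝ) ^ (3 : ℝ) * (ρ / R) ^ (3 : ℝ)) :=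
        ENNReal.ofReal_le_ofReal
          (le_mul_of_one_le_left hε.le (Real.one_le_rpow (by norm_num) (by norm_num)))
      obtain ⟨k₁, δ₁, hδ₁, hk₁⟩ := hP x ρ R hρ h14 hR1 _ hε
      obtain ⟨N, hN⟩ := Theorems.stub_travCount ρ δ₁ hρ hδ₁
      refine ⟨max k₁ N, fun _ _ _ δ hδ => ?_⟩
      by_cases hle : δ ≤ δ₁
      · calc SAW.law D.carrier δ (a δ) (b δ)
              {γ | (⟨γ.walk.toCurve (meshPoint δ)⟩ : Curve ℂ).HasTraversals (max k₁ N) x ρ R}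
            ≤ SAW.law D.carrier δ (a δ) (b δ)
              {γ | (⟨γ.walk.toCurve (meshPoint δ)⟩ : Curve ℂ).HasTraversals k₁ x ρ R} :=
              measure_mono fun γ hγ => Curve.HasTraversals.of_le hγ (le_max_left _ _)
          _ ≤ ENNReal.ofReal ((ρ / R) ^ (3 : ℝ)) := hk₁ δ ⟨hδ.1, hle⟩
          _ ≤ _ := hKε
      · have hempty :
            {γ : SAW.DomainSAW D.carrier δ (a δ) (b δ) |
              (⟨γ.walk.toCurve (meshPoint δ)⟩ : Curve ℂ).HasTraversals (max k₁ N) x ρ R} = ∅ :=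
          Set.eq_empty_iff_forall_notMem.2 fun γ hγ =>
            hN D.carrier δ (a δ) (b δ) γ x R (le_of_lt (not_le.1 hle)) hρR
              (Curve.HasTraversals.of_le hγ (le_max_right _ _))
        rw [hempty, measure_empty]
        exact bot_le
    · -- thin (or degenerate) shell: the bound is at least `1`
      refine ⟨0, fun hρ hρR hR1 δ hδ => ?_⟩
      have h14 : R ≤ 14 * ρ := by
        by_contra hcon
        exact h ⟨hρ, le_of_lt (not_le.1 hcon), hR1⟩
      exact Radial.law_le_bound_of_le_mul (by norm_num) (by norm_num) hρ (hρ.trans hρR) h14 le_rfl _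
  choose k hk using key
  refine ⟨k, (14 : ℝ) ^ (3 : ℝ), 3, 1, by norm_num, one_pos, fun δ hδ x ρ R hδρ hρR hR1 => ?_⟩
  exact hk x ρ R (hδ.1.trans_le hδρ) hρR hR1 δ hδ

/-! ## The decomposition and its honesty -/

/-- **`BulkShellTight → BoundaryShellTight → EventualTight`** (E-free, enlargement-free): fat per-shell count
tightness from the dichotomy, dressed as `ShellCrossingBound` per triple, then the landed Aizenman–Burchard
criterion `TightOfShellCrossing_proof`. [folklore glue] -/
theorem eventualTight_of_bulkShellTight_of_boundaryShellTight (hBulk : BulkShellTight)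
    (hBdry : Radial.BoundaryShellTight) : EventualTight :=
  TightOfShellCrossing_proof fun D a b hab =>
    shellCrossing_of_fatShellDecay D a b (fatShellTight_of_bulkShellTight_of_boundaryShellTight hBulk hBdry D a b hab)

/-- **The boundary statement is implied by the crux**: `EventualTight` gives per-shell count tightness at every
shell (`EventualTight.Sketch.shellCountTight_of_eventualTight`, landed), in particular at the frontier-centred
ones. [folklore] -/
theorem boundaryShellTight_of_eventualTight (hT : EventualTight) : Radial.BoundaryShellTight := by
  intro D a b hab x ρ R _ hρ h4 _ ε hε
  obtain ⟨δ₀, hδ₀, H⟩ := EventualTight.Sketch.shellCountTight_of_eventualTight hT D a b hab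
  obtain ⟨k, hk⟩ := H x ρ R hρ (by linarith) ε hε
  exact ⟨k, δ₀, hδ₀, hk⟩

/-- **`EventualTight ↔ BulkShellTight ∧ BoundaryShellTight`** — the exact, rate-free, E-free bulk/boundary
decomposition of the crux stmt-CriticalPhenomena-1372. [folklore] -/
theorem eventualTight_iff_bulkShellTight_and_boundaryShellTight :
    EventualTight ↔ (BulkShellTight ∧ Radial.BoundaryShellTight) :=
  ⟨fun hT => ⟨BulkShellTight.Negative.bulkShellTight_of_eventualTight hT, boundaryShellTight_of_eventualTight hT⟩,
    fun h => eventualTight_of_bulkShellTight_of_boundaryShellTight h.1 h.2⟩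

/-- **`¬ BoundaryShellTight → ¬ EventualTight`** (negatives-index form). [folklore] -/
theorem not_eventualTight_of_not_boundaryShellTight (h : ¬ Radial.BoundaryShellTight) : ¬ EventualTight :=
  fun hT => h (boundaryShellTight_of_eventualTight hT)

/-- **`SAWScalingLimit → BoundaryShellTight`**: the boundary statement is a consequence of the summit conjunct
(through `EventualTight.Negative.not_sawScalingLimit_of_not_eventualTight`), i.e. summit-safe. [folklore] -/
theorem boundaryShellTight_of_sawScalingLimit (h : SAW.SAWScalingLimit) : Radial.BoundaryShellTight := by
  by_contra hB
  exact EventualTight.Negative.not_sawScalingLimit_of_not_eventualTight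
    (not_eventualTight_of_not_boundaryShellTight hB) h

/-- **`¬ BoundaryShellTight → ¬ SAWScalingLimit`** (negatives-index form). [folklore] -/
theorem not_sawScalingLimit_of_not_boundaryShellTight (h : ¬ Radial.BoundaryShellTight) :
    ¬ SAW.SAWScalingLimit :=
  fun h' => h (boundaryShellTight_of_sawScalingLimit h')

/-! ## The line `boundary_bulk`: X2c₁ᵇ (stmt-18042) and the boundary statement give the crux -/

/-- **`EventualTight` from the bulk atom X2c₁ᵇ and the boundary statement** (the composition of the line
`Lines/boundary_bulk.lean`, E-free): X2c₁ᵇ ⟹ `BulkShellTight` (`bulkShellTight_of_virginArcTraversalTightBounded`,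
p151500), then `eventualTight_of_bulkShellTight_of_boundaryShellTight`. [folklore glue] -/
theorem eventualTight_of_virginArcTraversalTightBounded_of_boundaryShellTight
    (hXb : ∀ C θ : ℝ, 0 < θ →
      ∃ (k : ℕ) (N₀ : ℝ), 0 < N₀ ∧
        ∀ (H : SimpleGraph (Site 2)) (Λ : Set (Site 2)) (z₀ : ℂ) (N : ℝ) (u c u' c' : Site 2),
          Λ.Finite → (∀ v ∈ Λ, dist (Site.toComplex v) z₀ ≤ C * N) → N₀ ≤ N →
          (H ≤ zdGraph 2 ∧ (∀ v : Site 2, dist (Site.toComplex v) z₀ ≤ N → v ∈ Λ) ∧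
            ∀ v v' : Site 2, dist (Site.toComplex v) z₀ ≤ N + 1 →
              dist (Site.toComplex v') z₀ ≤ N + 1 → (zdGraph 2).Adj v v' → H.Adj v v') →
          (H.Adj u c ∧ u ∉ Λ ∧ c ∈ Λ ∧ dist (Site.toComplex c) z₀ ≤ N ∧
            N < dist (Site.toComplex u) z₀) →
          (H.Adj u' c' ∧ u' ∉ Λ ∧ c' ∈ Λ ∧ dist (Site.toComplex c') z₀ ≤ N ∧
            N < dist (Site.toComplex u') z₀) →
          ∑' p : {p : {p : H.Walk c c' // p.IsPath ∧ ∀ v ∈ p.support, v ∈ Λ} //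
              ∃ ι κ : Fin k → Fin (p.1.support.map Site.toComplex).length, (∀ m, ι m ≤ κ m) ∧
                (∀ m, (dist ((p.1.support.map Site.toComplex).get (ι m)) z₀ ≤ 2 * N / 5 ∧
                    3 * N / 5 ≤ dist ((p.1.support.map Site.toComplex).get (κ m)) z₀) ∨
                  (3 * N / 5 ≤ dist ((p.1.support.map Site.toComplex).get (ι m)) z₀ ∧
                    dist ((p.1.support.map Site.toComplex).get (κ m)) z₀ ≤ 2 * N / 5)) ∧
                ∀ ⦃m m'⦄, m < m' → κ m ≤ ι m'},
              ENNReal.ofReal (SAW.criticalFugacity ^ p.1.1.length) ≤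
            ENNReal.ofReal θ *
              ∑' p : {p : H.Walk c c' // p.IsPath ∧ ∀ v ∈ p.support, v ∈ Λ},
                ENNReal.ofReal (SAW.criticalFugacity ^ p.1.length))
    (hBdry : Radial.BoundaryShellTight) : EventualTight :=
  eventualTight_of_bulkShellTight_of_boundaryShellTight (bulkShellTight_of_virginArcTraversalTightBounded hXb) hBdry

/-- The same composition concluding the `SAWWeldingIdentification` copy of the crux decl (`Iff.rfl` bodies). -/
theorem eventualTight_welding_of_virginArcTraversalTightBounded_of_boundaryShellTight
    (hXb : ∀ C θ : ℝ, 0 < θ →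
      ∃ (k : ℕ) (N₀ : ℝ), 0 < N₀ ∧
        ∀ (H : SimpleGraph (Site 2)) (Λ : Set (Site 2)) (z₀ : ℂ) (N : ℝ) (u c u' c' : Site 2),
          Λ.Finite → (∀ v ∈ Λ, dist (Site.toComplex v) z₀ ≤ C * N) → N₀ ≤ N →
          (H ≤ zdGraph 2 ∧ (∀ v : Site 2, dist (Site.toComplex v) z₀ ≤ N → v ∈ Λ) ∧
            ∀ v v' : Site 2, dist (Site.toComplex v) z₀ ≤ N + 1 →
              dist (Site.toComplex v') z₀ ≤ N + 1 → (zdGraph 2).Adj v v' → H.Adj v v') →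
          (H.Adj u c ∧ u ∉ Λ ∧ c ∈ Λ ∧ dist (Site.toComplex c) z₀ ≤ N ∧
            N < dist (Site.toComplex u) z₀) →
          (H.Adj u' c' ∧ u' ∉ Λ ∧ c' ∈ Λ ∧ dist (Site.toComplex c') z₀ ≤ N ∧
            N < dist (Site.toComplex u') z₀) →
          ∑' p : {p : {p : H.Walk c c' // p.IsPath ∧ ∀ v ∈ p.support, v ∈ Λ} //
              ∃ ι κ : Fin k → Fin (p.1.support.map Site.toComplex).length, (∀ m, ι m ≤ κ m) ∧
                (∀ m, (dist ((p.1.support.map Site.toComplex).get (ι m)) z₀ ≤ 2 * N / 5 ∧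
                    3 * N / 5 ≤ dist ((p.1.support.map Site.toComplex).get (κ m)) z₀) ∨
                  (3 * N / 5 ≤ dist ((p.1.support.map Site.toComplex).get (ι m)) z₀ ∧
                    dist ((p.1.support.map Site.toComplex).get (κ m)) z₀ ≤ 2 * N / 5)) ∧
                ∀ ⦃m m'⦄, m < m' → κ m ≤ ι m'},
              ENNReal.ofReal (SAW.criticalFugacity ^ p.1.1.length) ≤
            ENNReal.ofReal θ *
              ∑' p : {p : H.Walk c c' // p.IsPath ∧ ∀ v ∈ p.support, v ∈ Λ},
                ENNReal.ofReal (SAW.criticalFugacity ^ p.1.length))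
    (hBdry : Radial.BoundaryShellTight) :
    Summit.CriticalPhenomena.SAWScalingLimit.Theses.SAWWeldingIdentification.EventualTight :=
  eventualTight_of_virginArcTraversalTightBounded_of_boundaryShellTight hXb hBdry

/-- **The split of record implies the new pair**: X2c₁ᵇ and E (`ConfinementPositivity`, stmt-17587) give the crux
(`eventualTight_of_virginArcTraversalTightBounded_of_confinementPositivity`, p151500), hence the boundary statement;
so {X2c₁ᵇ, `BoundaryShellTight`} is a weakly WEAKER sufficient pair than {X2c₁ᵇ, E}. [folklore] -/
theorem boundaryShellTight_of_virginArcTraversalTightBounded_of_confinementPositivity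
    (hXb : ∀ C θ : ℝ, 0 < θ →
      ∃ (k : ℕ) (N₀ : ℝ), 0 < N₀ ∧
        ∀ (H : SimpleGraph (Site 2)) (Λ : Set (Site 2)) (z₀ : ℂ) (N : ℝ) (u c u' c' : Site 2),
          Λ.Finite → (∀ v ∈ Λ, dist (Site.toComplex v) z₀ ≤ C * N) → N₀ ≤ N →
          (H ≤ zdGraph 2 ∧ (∀ v : Site 2, dist (Site.toComplex v) z₀ ≤ N → v ∈ Λ) ∧
            ∀ v v' : Site 2, dist (Site.toComplex v) z₀ ≤ N + 1 →
              dist (Site.toComplex v') z₀ ≤ N + 1 → (zdGraph 2).Adj v v' → H.Adj v v') →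
          (H.Adj u c ∧ u ∉ Λ ∧ c ∈ Λ ∧ dist (Site.toComplex c) z₀ ≤ N ∧
            N < dist (Site.toComplex u) z₀) →
          (H.Adj u' c' ∧ u' ∉ Λ ∧ c' ∈ Λ ∧ dist (Site.toComplex c') z₀ ≤ N ∧
            N < dist (Site.toComplex u') z₀) →
          ∑' p : {p : {p : H.Walk c c' // p.IsPath ∧ ∀ v ∈ p.support, v ∈ Λ} //
              ∃ ι κ : Fin k → Fin (p.1.support.map Site.toComplex).length, (∀ m, ι m ≤ κ m) ∧
                (∀ m, (dist ((p.1.support.map Site.toComplex).get (ι m)) z₀ ≤ 2 * N / 5 ∧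
                    3 * N / 5 ≤ dist ((p.1.support.map Site.toComplex).get (κ m)) z₀) ∨
                  (3 * N / 5 ≤ dist ((p.1.support.map Site.toComplex).get (ι m)) z₀ ∧
                    dist ((p.1.support.map Site.toComplex).get (κ m)) z₀ ≤ 2 * N / 5)) ∧
                ∀ ⦃m m'⦄, m < m' → κ m ≤ ι m'},
              ENNReal.ofReal (SAW.criticalFugacity ^ p.1.1.length) ≤
            ENNReal.ofReal θ *
              ∑' p : {p : H.Walk c c' // p.IsPath ∧ ∀ v ∈ p.support, v ∈ Λ},
                ENNReal.ofReal (SAW.criticalFugacity ^ p.1.length))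
    (hE : ConfinementPositivity) : Radial.BoundaryShellTight :=
  boundaryShellTight_of_eventualTight (eventualTight_of_virginArcTraversalTightBounded_of_confinementPositivity hXb hE)

end Summit.CriticalPhenomena.SAWScalingLimit.Theorems

end
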